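import Mathlib
import Literature.NumberTheory.Transcendental.ZagierDilogarithmConjecture
import Literature.NumberTheory.Transcendental.BlochWignerDilogarithm
import HarnessLib

/-!
# `ZagierDilogarithmConjecture` (stmt-KontsevichZagierPeriods-10550) — line
`kummer-clausen-linearisation` (reshape c5, "the cyclotomic tower and the abelian sector"), stub
`stub_cyclotomicFolding`

**Folding a cyclotomic combination onto the primitive residues of the open upper half.** Let
`ζ = ζ_N = e^{2πi/N}` and let `R̄ = ⟨dilogRelators⟩ ⊆ ℤ[ℂ]` be the relator group of Zagier's
dilogarithm conjecture (Neumann 1998, §2.1). ASSUME the spanning statement (the neighbouring stub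
`stub_cyclotomicSpanning`, taken here only as the antecedent of the theorem): every class `[ζ^c]`
(`c mod N`) has a positive multiple congruent mod `R̄` to a `ℤ`-combination of UNIT classes `[ζ^a]`,
`a ∈ (ℤ/N)ˣ`. THEN every combination `x = Σ_c m_c [ζ^c]` has a positive multiple `M • x` congruent
mod `R̄` to a `ℤ`-combination of the classes `[ζ^a]` with `a` a unit of the OPEN UPPER HALF
(`(a, N) = 1`, `0 < a < N/2`) — exactly the index set of Milnor's conjecture (Milnor 1982, Appendix).
This feeds `stub_cyclotomicTorsionDescent` and `stub_cyclotomicSectorTorsion_iff`.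

Proof. Say `x` FOLDS (w.r.t. a subgroup `R`, a family `P` and a set `U` of indices) if some `M ≥ 1`
and some `b` supported on `U` satisfy `M • x − Σ_a b_a • P a ∈ R`. The folding elements form a
subgroup (`CyclotomicFolding.exists_addSubgroup_fold`: multiply the two multipliers); `x` folds if
`M • x ∈ R` (`b = 0`) or `x − ε • P a ∈ R` with `a ∈ U` (`b = ε δ_a`); and folding is saturated
(`K • x` folds, `K ≥ 1` ⇒ `x` folds). Take `R = R̄`, `P a = [ζ ^ a.val]` (`a mod N`) and `U` = the
units of the open upper half. A unit class `[ζ^a]` folds: for `0 < a < N/2` trivially; for `a = 0`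
because `[1] ∈ R̄` (a real point); otherwise `N ≤ 2a < 2N`, and with `conj (ζ^{N−a}) = ζ^a` the
conjugation relator gives `[ζ^{N−a}] + [ζ^a] ∈ R̄` (`ζ^{N−a}` is algebraic), so either `2a = N`,
where `−a = a` and `2 • [ζ^a] ∈ R̄`, or `N < 2a`, where `−a` is a unit of the open upper half and
`[ζ^a] − (−1) • [ζ^{(−a).val}] ∈ R̄`. Hence, by spanning, `M_c • [ζ^c] ∈ R̄ + Σ_a b_{c,a} [ζ^a]`
folds, so does `[ζ^c]` for every `c`, and so does `x = Σ_c m_c [ζ^c]` — which is the claim.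
Sorry-free; axioms ⊆ {propext, Classical.choice, Quot.sound}.

## References

* W. D. Neumann, *Hilbert's 3rd problem and invariants of 3-manifolds*, Geom. Topol. Monogr. 1
  (1998), §2.1 (the relations `D₂(z̄) = −D₂(z)` and `D₂|_ℝ = 0`). [Neumann1998]
* J. Milnor, *Hyperbolic geometry: the first 150 years*, Bull. AMS 6 (1982), Appendix. [Milnor1982]
-/

noncomputable section

open scoped BigOperators ComplexConjugate
open Literature.NumberTheory.Transcendental

namespace Summit.KontsevichZagierPeriods.HyperbolicBloch.ZagierDilogarithmCyclotomic

namespace CyclotomicFolding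

/-! ### Folding modulo a subgroup onto a prescribed index set -/

section Fold

variable {G : Type*} [AddCommGroup G] {ι : Type*} [Fintype ι]

/-- **The folding elements form a subgroup.** For a subgroup `R ≤ G`, a family `P : ι → G` and a set
`U` of indices, the elements `x ∈ G` having a positive multiple `M • x` congruent mod `R` to a
`ℤ`-combination `Σ_a b_a • P a` with `b` supported on `U` form a subgroup of `G` (for a sum, multiply
the two multipliers). [folklore] -/
theorem exists_addSubgroup_fold (R : AddSubgroup G) (P : ι → G) (U : ι → Prop) :
    ∃ T : AddSubgroup G, ∀ x, x ∈ T ↔ ∃ M : ℕ, 0 < M ∧ ∃ b : ι → ℤ, (∀ a, b a ≠ 0 → U a) ∧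
      (M • x - ∑ a, b a • P a) ∈ R := by
  refine ⟨{ carrier := {x | ∃ M : ℕ, 0 < M ∧ ∃ b : ι → ℤ, (∀ a, b a ≠ 0 → U a) ∧
                (M • x - ∑ a, b a • P a) ∈ R}
            add_mem' := ?add
            zero_mem' := ⟨1, Nat.one_pos, 0, fun _ ha => (ha rfl).elim, by simp⟩
            neg_mem' := ?neg }, fun x => Iff.rfl⟩
  case add =>
    rintro x y ⟨M₁, hM₁, b₁, hb₁, hx⟩ ⟨M₂, hM₂, b₂, hb₂, hy⟩
    refine ⟨M₁ * M₂, Nat.mul_pos hM₁ hM₂, fun a => M₂ * b₁ a + M₁ * b₂ a, fun a ha => ?_, ?_⟩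
    · by_contra hU
      have h₁ : b₁ a = 0 := by_contra fun h => hU (hb₁ a h)
      have h₂ : b₂ a = 0 := by_contra fun h => hU (hb₂ a h)
      exact ha (show (M₂ : ℤ) * b₁ a + M₁ * b₂ a = 0 by rw [h₁, h₂, mul_zero, mul_zero, add_zero])
    · have hmem : (M₂ : ℤ) • (M₁ • x - ∑ a, b₁ a • P a) +
          (M₁ : ℤ) • (M₂ • y - ∑ a, b₂ a • P a) ∈ R :=
        R.add_mem (R.zsmul_mem hx _) (R.zsmul_mem hy _)
      convert hmem using 1
      simp only [add_smul, mul_smul, Finset.sum_add_distrib, Finset.smul_sum, smul_add, smul_sub]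
      module
  case neg =>
    rintro x ⟨M, hM, b, hb, hx⟩
    refine ⟨M, hM, -b, fun a ha => hb a fun h => ha (by rw [Pi.neg_apply, h, neg_zero]), ?_⟩
    convert R.neg_mem hx using 1
    simp only [Pi.neg_apply, neg_smul, Finset.sum_neg_distrib, smul_neg]
    abel

/-- If `M • x ∈ R` for some `M ≥ 1` then `x` folds (`b = 0`). [folklore] -/
theorem exists_fold_of_nsmul_mem (R : AddSubgroup G) (P : ι → G) (U : ι → Prop) {x : G} {M : ℕ}
    (hM : 0 < M) (h : M • x ∈ R) :
    ∃ M : ℕ, 0 < M ∧ ∃ b : ι → ℤ, (∀ a, b a ≠ 0 → U a) ∧ (M • x - ∑ a, b a • P a) ∈ R :=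
  ⟨M, hM, 0, fun _ ha => (ha rfl).elim, by simpa using h⟩

/-- If `x - ε • P a ∈ R` with `a ∈ U` then `x` folds (`M = 1`, `b = ε δ_a`). [folklore] -/
theorem exists_fold_of_sub_zsmul_mem [DecidableEq ι] (R : AddSubgroup G) (P : ι → G)
    (U : ι → Prop) {x : G} {a : ι} (ha : U a) (ε : ℤ) (h : x - ε • P a ∈ R) :
    ∃ M : ℕ, 0 < M ∧ ∃ b : ι → ℤ, (∀ a, b a ≠ 0 → U a) ∧ (M • x - ∑ a, b a • P a) ∈ R := by
  refine ⟨1, Nat.one_pos, Pi.single a ε, fun c hc => ?_, ?_⟩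
  · have hca : c = a := by
      by_contra hne
      rw [Pi.single_apply, if_neg hne] at hc
      exact hc rfl
    rw [hca]
    exact ha
  · rwa [one_nsmul, Finset.sum_eq_single a
      (fun c _ hne => by rw [Pi.single_apply, if_neg hne, zero_zsmul])
      (fun h => absurd (Finset.mem_univ a) h), Pi.single_eq_same]

/-- Folding is saturated: if `K • x` folds for some `K ≥ 1` then `x` folds (multiply the
multipliers). [folklore] -/
theorem exists_fold_of_nsmul {R : AddSubgroup G} {P : ι → G} {U : ι → Prop} {x : G} {K : ℕ}
    (hK : 0 < K)
    (h : ∃ M : ℕ, 0 < M ∧ ∃ b : ι → ℤ, (∀ a, b a ≠ 0 → U a) ∧ (M • K • x - ∑ a, b a • P a) ∈ R) :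
    ∃ M : ℕ, 0 < M ∧ ∃ b : ι → ℤ, (∀ a, b a ≠ 0 → U a) ∧ (M • x - ∑ a, b a • P a) ∈ R := by
  obtain ⟨M, hM, b, hb, hmem⟩ := h
  exact ⟨M * K, Nat.mul_pos hM hK, b, hb, by rwa [mul_nsmul']⟩

end Fold

/-! ### Roots of unity: conjugation folds the lower half onto the upper half -/

section Cyclotomic

variable {N : ℕ} [NeZero N] {ζ : ℂ}

/-- Powers of a primitive `N`-th root of unity are algebraic (roots of `X ^ N - 1`). [folklore] -/
theorem isAlgebraic_pow_of_isPrimitiveRoot (hζ : IsPrimitiveRoot ζ N) (k : ℕ) :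
    IsAlgebraic ℚ (ζ ^ k) := by
  refine ⟨Polynomial.X ^ N - Polynomial.C 1, Polynomial.X_pow_sub_C_ne_zero (NeZero.pos N) 1, ?_⟩
  rw [map_sub, map_pow, Polynomial.aeval_X, Polynomial.aeval_C, map_one, ← pow_mul, pow_mul',
    hζ.pow_eq_one, one_pow, sub_self]

/-- `ζ ^ (-a).val * ζ ^ a.val = 1`: the exponents add up to `0 mod N`. [folklore] -/
theorem pow_neg_val_mul_pow_val (hζ : IsPrimitiveRoot ζ N) (a : ZMod N) :
    ζ ^ (-a).val * ζ ^ a.val = 1 := by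
  rw [← pow_add, hζ.pow_eq_one_iff_dvd]
  refine Nat.dvd_of_mod_eq_zero ?_
  rw [← ZMod.val_add, neg_add_cancel, ZMod.val_zero]

/-- `conj (ζ ^ (-a).val) = ζ ^ a.val`, as `‖ζ‖ = 1`. [folklore] -/
theorem conj_pow_neg_val (hζ : IsPrimitiveRoot ζ N) (a : ZMod N) :
    conj (ζ ^ (-a).val) = ζ ^ a.val := by
  have hnorm : ‖ζ ^ (-a).val‖ = 1 := by
    rw [norm_pow, hζ.norm'_eq_one (NeZero.ne N), one_pow]
  rw [← Complex.inv_eq_conj hnorm]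
  exact inv_eq_of_mul_eq_one_right (pow_neg_val_mul_pow_val hζ a)

/-- The conjugation relator of a pair of opposite residues: `[ζ ^ (-a).val] + [ζ ^ a.val] ∈ R̄`
(`D₂(z̄) = −D₂(z)`). [cite: Neumann1998, Thm 2.4] -/
theorem of_pow_neg_val_add_mem (hζ : IsPrimitiveRoot ζ N) (a : ZMod N) :
    FreeAbelianGroup.of (ζ ^ (-a).val) + FreeAbelianGroup.of (ζ ^ a.val) ∈
      AddSubgroup.closure dilogRelators := by
  have h := of_add_of_conj_mem_dilogRelators (isAlgebraic_pow_of_isPrimitiveRoot hζ (-a).val)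
  rw [conj_pow_neg_val hζ a] at h
  exact AddSubgroup.subset_closure h

/-- Every UNIT class `[ζ ^ a.val]` folds mod `R̄` onto the units of the open upper half: for
`0 < a < N/2` trivially, `[ζ ^ 0] = [1]` is a real point, for `2a = N` twice the class is a
conjugation relator (`-a = a`), and for `N < 2a` the class plus `[ζ ^ (-a).val]` is a conjugation
relator with `-a` a unit of the open upper half. [folklore] -/
theorem exists_fold_of_isUnit (hζ : IsPrimitiveRoot ζ N) {a : ZMod N} (ha : IsUnit a) :
    ∃ M : ℕ, 0 < M ∧ ∃ b : ZMod N → ℤ, (∀ c, b c ≠ 0 → IsUnit c ∧ 0 < c.val ∧ 2 * c.val < N) ∧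
      (M • FreeAbelianGroup.of (ζ ^ a.val) -
        ∑ c : ZMod N, b c • FreeAbelianGroup.of (ζ ^ c.val)) ∈ AddSubgroup.closure dilogRelators := by
  by_cases hup : 0 < a.val ∧ 2 * a.val < N
  · exact exists_fold_of_sub_zsmul_mem _ _ _ (a := a) ⟨ha, hup⟩ 1
      (by rw [one_zsmul, sub_self]; exact zero_mem _)
  by_cases ha0 : a = 0
  · refine exists_fold_of_nsmul_mem _ _ _ Nat.one_pos ?_
    rw [one_nsmul, ha0, ZMod.val_zero, pow_zero]
    exact AddSubgroup.subset_closure (of_real_mem_dilogRelators Complex.one_im)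
  have hpos : 0 < a.val := Nat.pos_of_ne_zero fun h => ha0 ((ZMod.val_eq_zero a).1 h)
  have hge : N ≤ 2 * a.val := not_lt.1 fun h => hup ⟨hpos, h⟩
  have hlt : a.val < N := ZMod.val_lt a
  have hneg : (-a).val = N - a.val := by rw [ZMod.neg_val, if_neg ha0]
  have hrel := of_pow_neg_val_add_mem hζ a
  rcases hge.eq_or_lt with heq | hgt
  · -- `2a = N`: `-a = a`, so `2 • [ζ ^ a.val] ∈ R̄`
    have hna : -a = a := ZMod.val_injective N (by omega)
    rw [hna, ← two_nsmul] at hrel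
    exact exists_fold_of_nsmul_mem _ _ _ two_pos hrel
  · -- `N < 2a`: `-a` is a unit of the open upper half
    have hU : IsUnit (-a) ∧ 0 < (-a).val ∧ 2 * (-a).val < N := ⟨ha.neg, by omega, by omega⟩
    refine exists_fold_of_sub_zsmul_mem _ _ _ (a := -a) hU (-1) ?_
    rwa [neg_one_zsmul, sub_neg_eq_add, add_comm]

/-- Under the spanning hypothesis at level `N` (every class has a positive multiple congruent mod
`R̄` to a unit-supported combination), EVERY class `[ζ ^ c.val]` folds mod `R̄` onto the units of
the open upper half. [folklore] -/
theorem exists_fold_of_spanning (hζ : IsPrimitiveRoot ζ N)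
    (hspan : ∀ c : ZMod N, ∃ M : ℕ, 0 < M ∧ ∃ b : ZMod N → ℤ, (∀ a, b a ≠ 0 → IsUnit a) ∧
      (M • FreeAbelianGroup.of (ζ ^ c.val) -
        ∑ a : ZMod N, b a • FreeAbelianGroup.of (ζ ^ a.val)) ∈ AddSubgroup.closure dilogRelators)
    (c : ZMod N) :
    ∃ M : ℕ, 0 < M ∧ ∃ b : ZMod N → ℤ, (∀ a, b a ≠ 0 → IsUnit a ∧ 0 < a.val ∧ 2 * a.val < N) ∧
      (M • FreeAbelianGroup.of (ζ ^ c.val) -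
        ∑ a : ZMod N, b a • FreeAbelianGroup.of (ζ ^ a.val)) ∈ AddSubgroup.closure dilogRelators := by
  obtain ⟨T, hT⟩ := exists_addSubgroup_fold (AddSubgroup.closure dilogRelators)
    (fun a : ZMod N => FreeAbelianGroup.of (ζ ^ a.val))
    (fun a : ZMod N => IsUnit a ∧ 0 < a.val ∧ 2 * a.val < N)
  obtain ⟨M, hM, B, hB, hmem⟩ := hspan c
  refine exists_fold_of_nsmul hM ((hT _).1 ?_)
  rw [← sub_add_cancel (M • FreeAbelianGroup.of (ζ ^ c.val))
    (∑ a : ZMod N, B a • FreeAbelianGroup.of (ζ ^ a.val))]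
  refine add_mem ((hT _).2 (exists_fold_of_nsmul_mem _ _ _ Nat.one_pos (by rwa [one_nsmul])))
    (sum_mem fun a _ => ?_)
  by_cases hBa : B a = 0
  · rw [hBa, zero_zsmul]
    exact zero_mem _
  · exact zsmul_mem ((hT _).2 (exists_fold_of_isUnit hζ (hB a hBa))) _

end Cyclotomic

end CyclotomicFolding

open CyclotomicFolding

/-! ### The stub -/

/-- **Stub `stub_cyclotomicFolding` (folding a cyclotomic combination onto the Milnor index set).**
Assume the spanning statement: for every `N ≥ 1` and every residue `c mod N`, some positive multiple
of `[ζ_N ^ c]` is congruent mod `⟨dilogRelators⟩` to a `ℤ`-combination of unit classes `[ζ_N ^ a]`,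
`a ∈ (ℤ/N)ˣ`. Then for every `N ≥ 1` and every `m : ℤ/N → ℤ` there are `M ≥ 1` and `b : ℤ/N → ℤ`
supported on the units `a` of the open upper half (`0 < a < N/2`) with
`M • Σ_c m_c [ζ_N ^ c] − Σ_a b_a [ζ_N ^ a] ∈ ⟨dilogRelators⟩`: the folding elements form a subgroup,
every class folds (spanning, then the real relator `[1]` and the conjugation relators
`[ζ_N ^ (N - a)] + [ζ_N ^ a]` fold the remaining unit classes to the upper half), hence so does the
combination. [cite: Neumann1998, §2.1] -/
theorem stub_cyclotomicFolding :
    (∀ (N : ℕ) [NeZero N] (c : ZMod N), ∃ M : ℕ, 0 < M ∧ ∃ b : ZMod N → ℤ, (∀ a, b a ≠ 0 → IsUnit a) ∧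
      (M • FreeAbelianGroup.of (Complex.exp (2 * Real.pi * Complex.I / N) ^ c.val) -
        ∑ a : ZMod N, b a • FreeAbelianGroup.of (Complex.exp (2 * Real.pi * Complex.I / N) ^ a.val)) ∈
        AddSubgroup.closure dilogRelators) →
    ∀ (N : ℕ) [NeZero N] (m : ZMod N → ℤ), ∃ M : ℕ, 0 < M ∧ ∃ b : ZMod N → ℤ,
      (∀ a, b a ≠ 0 → IsUnit a ∧ 0 < a.val ∧ 2 * a.val < N) ∧
      (M • ∑ c : ZMod N, m c • FreeAbelianGroup.of (Complex.exp (2 * Real.pi * Complex.I / N) ^ c.val) -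
        ∑ a : ZMod N, b a • FreeAbelianGroup.of (Complex.exp (2 * Real.pi * Complex.I / N) ^ a.val)) ∈
        AddSubgroup.closure dilogRelators := by
  intro hspan N _ m
  have hζ : IsPrimitiveRoot (Complex.exp (2 * Real.pi * Complex.I / N)) N :=
    Complex.isPrimitiveRoot_exp N (NeZero.ne N)
  obtain ⟨T, hT⟩ := exists_addSubgroup_fold (AddSubgroup.closure dilogRelators)
    (fun a : ZMod N => FreeAbelianGroup.of (Complex.exp (2 * Real.pi * Complex.I / N) ^ a.val))
    (fun a : ZMod N => IsUnit a ∧ 0 < a.val ∧ 2 * a.val < N)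
  exact (hT _).1
    (sum_mem fun c _ => zsmul_mem ((hT _).2 (exists_fold_of_spanning hζ (hspan N) c)) _)

end Summit.KontsevichZagierPeriods.HyperbolicBloch.ZagierDilogarithmCyclotomic

end
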